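import Literature.Computability.AlgebraicComplexity.AndrewsForbes2022BideterminantPartialsProofs
import Literature.Computability.AlgebraicComplexity.AndrewsForbes2022Prop35Infinite
import Literature.Computability.AlgebraicComplexity.LaurentPolyOrder
import HarnessLib

/-!
# Discharge of `AndrewsForbes2022_thm_5_4` and `AndrewsForbes2022_thm_5_4_charZero`:
# partial derivatives in determinantal ideals (Andrews–Forbes 2022, Theorem 5.4)
(cell val-lit, seat t22 on discharge duty; facts typed by t24 in
`AndrewsForbes2022DeterminantalIdeals.lean`)

R. Andrews, M. A. Forbes, *Ideals, determinants, and straightening: proving and using lower bounds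
for polynomial ideals*, STOC 2022 / arXiv:2112.00792, Theorem 5.4 (p. 30): for every nonzero
`f ∈ I^det_{n,m,r}`, `dim ∂_{<∞}(f) ≥ binom(2r, r)`, and in characteristic zero
`dim ∂_{≤d}(f) ≥ Σ_{i ≤ d} binom(r, i)²`. HONEST FRAMING: classical commutative algebra; nothing here
bears on `VP ≠ VNP` beyond discharging two typed literature facts.

## The printed proof (p0030:L112–L125) and how it is followed

* "Apply Prop. 3.5 to `f` to obtain linear functions `ℓ_{i,j}(X, ε) ∈ F(ε)[X]` such that
  `g(X, ε) := ε^{-q} f(ℓ(X, ε)) = α (K_σ|K_σ)(X) + O(ε)`, `σ₁ ≥ r`": the tree's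
  `AndrewsForbes2022_prop_3_5_of_infinite` (Prop. 3.5 over every infinite field; the paper works in
  characteristic zero "for simplicity", the printed Prop. 3.5 has no characteristic hypothesis). For a
  FINITE field we first extend scalars to the infinite field `L = F(t)`: only the inequality
  `dim_K ∂(f ⊗ K) ≤ dim_F ∂(f)` (a spanning set stays spanning, `finrank_partialSpace_map_le`) is
  ever used, so no descent is needed and Theorem 5.4's first part comes out over EVERY field, as typed.
* "By Prop. 5.3, `dim ∂_{<∞}(g(X,0)) ≥ binom(2σ₁, σ₁) ≥ binom(2r, r)`. This implies
  `dim ∂_{<∞}(g(X, ε)) ≥ binom(2r, r)`": the linearly independent family of Prop. 5.3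
  (`linearIndependent_hasseIdx_family`, one Hasse derivative per pair of equinumerous subsets of the
  longest row of `(K_σ|K_σ)`, separated by multidegree) stays linearly independent over `F(ε)` after
  an `O(ε)` perturbation: a dependency, normalised to `ε`-order `0`, would reduce modulo `ε` to a
  dependency of the own-monomial coefficients (`linearIndependent_of_isOrdGE_sub`; the `ε`-orders are
  book-kept in `F((ε))` with the tree's `IsOrdGE`, `isBigOEps_iff_isOrdGE`).
* "Since `x ↦ ℓ(x, ε)` is invertible, Lemma 2.20 gives `dim ∂(f) = dim ∂(g)`": t24's
  `finrank_partialSpaceLE_linSubst_eq` over `F(ε)` (with `∂_{<∞} = ∂_{≤ deg}`,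
  `partialSpaceLE_eq_partialSpace`), the unit `ε^{-q}` being harmless (`partialSpace_C_mul`).
* `binom(2σ₁, σ₁) ≥ binom(2r, r)` for `σ₁ ≥ r` (`centralBinom_mono`); the characteristic-zero clause
  runs the same pipeline with `∂_{≤d}` and the first-order family (`linearIndependent_sqfree_family`).

## References

* [AndrewsForbes2022] R. Andrews, M. A. Forbes, *Ideals, determinants, and straightening*, STOC 2022;
  arXiv:2112.00792, Theorem 5.4 (p. 30), Proposition 3.5 (p. 21), Lemma 2.20 (p. 14).
-/

noncomputable section

open MvPolynomial Literature.Barriers.ValiantsHypothesis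
open scoped Pointwise RatFunc LaurentSeries

namespace Literature.Computability.AlgebraicComplexity

/-! ## More Hasse-derivative calculus: scalars, base change, large orders -/

section HasseMore

variable {R S : Type*} [CommSemiring R] [CommSemiring S] {σ : Type*}

/-- Hasse derivatives commute with constant factors (Def. 2.13 is linear).
[cite: AndrewsForbes2022, Def. 2.13] -/
theorem mvHasseDeriv_C_mul (c : R) (a : σ →₀ ℕ) (f : MvPolynomial σ R) :
    mvHasseDeriv a (C c * f) = C c * mvHasseDeriv a f := by
  ext e
  rw [coeff_mvHasseDeriv, coeff_C_mul, coeff_C_mul, coeff_mvHasseDeriv]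
  ring

/-- Hasse derivatives commute with extension of scalars (Lemma 2.14 is defined over `ℤ`).
[cite: AndrewsForbes2022, Lemma 2.14] -/
theorem mvHasseDeriv_map (φ : R →+* S) (a : σ →₀ ℕ) (f : MvPolynomial σ R) :
    mvHasseDeriv a (MvPolynomial.map φ f) = MvPolynomial.map φ (mvHasseDeriv a f) := by
  ext e
  rw [coeff_mvHasseDeriv, coeff_map, coeff_map, coeff_mvHasseDeriv, map_mul]
  congr 1
  rw [Finsupp.prod, Finsupp.prod, map_prod]
  simp only [map_natCast]

/-- A Hasse derivative of order exceeding the degree vanishes ("by taking `d ≥ deg f` one can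
replace `∂_{≤d}` with `∂_{<∞}`", p0015:L9). [cite: AndrewsForbes2022, Lemma 2.20 (remark after)] -/
theorem mvHasseDeriv_eq_zero_of_totalDegree_lt {a : σ →₀ ℕ} {f : MvPolynomial σ R}
    (h : f.totalDegree < Finsupp.degree a) : mvHasseDeriv a f = 0 := by
  ext e
  rw [coeff_mvHasseDeriv, coeff_zero, coeff_eq_zero_of_totalDegree_lt, mul_zero]
  rw [← Finsupp.degree_apply, map_add]
  omega

variable {F : Type*} [Field F]

/-- `∂_{≤d}(f) = ∂_{<∞}(f)` for `d ≥ deg f` (p0015:L9). [cite: AndrewsForbes2022, Lemma 2.20 (remark after)] -/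
theorem partialSpaceLE_eq_partialSpace {d : ℕ} {f : MvPolynomial σ F} (h : f.totalDegree ≤ d) :
    partialSpaceLE d f = partialSpace f := by
  refine le_antisymm (partialSpaceLE_le d f) (Submodule.span_le.2 ?_)
  rintro _ ⟨a, rfl⟩
  change mvHasseDeriv a f ∈ partialSpaceLE d f
  by_cases ha : Finsupp.degree a ≤ d
  · exact Submodule.subset_span ⟨a, ha, rfl⟩
  · have h0 : mvHasseDeriv a f = 0 := mvHasseDeriv_eq_zero_of_totalDegree_lt (by omega)
    rw [h0]
    exact Submodule.zero_mem _

/-- Scaling by a nonzero constant does not change `∂_{<∞}`. [cite: AndrewsForbes2022, Def. 2.19] -/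
theorem partialSpace_C_mul {c : F} (hc : c ≠ 0) (f : MvPolynomial σ F) :
    partialSpace (C c * f) = partialSpace f := by
  refine le_antisymm (Submodule.span_le.2 ?_) (Submodule.span_le.2 ?_)
  · rintro _ ⟨a, rfl⟩
    change mvHasseDeriv a (C c * f) ∈ partialSpace f
    rw [mvHasseDeriv_C_mul, ← smul_eq_C_mul]
    exact Submodule.smul_mem _ _ (Submodule.subset_span ⟨a, rfl⟩)
  · rintro _ ⟨a, rfl⟩
    change mvHasseDeriv a f ∈ partialSpace (C c * f)
    have h : mvHasseDeriv a f = c⁻¹ • mvHasseDeriv a (C c * f) := by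
      rw [mvHasseDeriv_C_mul, ← smul_eq_C_mul, smul_smul, inv_mul_cancel₀ hc, one_smul]
    rw [h]
    exact Submodule.smul_mem _ _ (Submodule.subset_span ⟨a, rfl⟩)

/-- Scaling by a nonzero constant does not change `∂_{≤d}`. [cite: AndrewsForbes2022, Def. 2.19] -/
theorem partialSpaceLE_C_mul {c : F} (hc : c ≠ 0) (d : ℕ) (f : MvPolynomial σ F) :
    partialSpaceLE d (C c * f) = partialSpaceLE d f := by
  refine le_antisymm (Submodule.span_le.2 ?_) (Submodule.span_le.2 ?_)
  · rintro _ ⟨a, ha, rfl⟩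
    change mvHasseDeriv a (C c * f) ∈ partialSpaceLE d f
    rw [mvHasseDeriv_C_mul, ← smul_eq_C_mul]
    exact Submodule.smul_mem _ _ (Submodule.subset_span ⟨a, ha, rfl⟩)
  · rintro _ ⟨a, ha, rfl⟩
    change mvHasseDeriv a f ∈ partialSpaceLE d (C c * f)
    have h : mvHasseDeriv a f = c⁻¹ • mvHasseDeriv a (C c * f) := by
      rw [mvHasseDeriv_C_mul, ← smul_eq_C_mul, smul_smul, inv_mul_cancel₀ hc, one_smul]
    rw [h]
    exact Submodule.smul_mem _ _ (Submodule.subset_span ⟨a, ha, rfl⟩)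

/-- Lemma 2.20 for `∂_{<∞}`: an invertible linear change of variables preserves `dim ∂_{<∞}`
("by taking `d ≥ deg f` one can replace `∂_{≤d}` with `∂_{<∞}`"). [cite: AndrewsForbes2022, Lemma 2.20] -/
theorem finrank_partialSpace_linSubst_eq {τ : Type*} [Fintype τ] [DecidableEq τ]
    (A : Matrix τ τ F) (hA : IsUnit A) (f : MvPolynomial τ F) :
    Module.finrank F (partialSpace (Lemma220.linSubst A f)) =
      Module.finrank F (partialSpace f) := by
  rw [← partialSpaceLE_eq_partialSpace
      (le_max_left (Lemma220.linSubst A f).totalDegree f.totalDegree),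
    ← partialSpaceLE_eq_partialSpace
      (le_max_right (Lemma220.linSubst A f).totalDegree f.totalDegree)]
  exact finrank_partialSpaceLE_linSubst_eq A hA _ f

/-- Extension of scalars `F → K` can only DECREASE `dim ∂_{≤d}` as computed over the larger field
(a spanning set of `∂_{≤d}(f)` stays spanning for `∂_{≤d}(f ⊗ K)`; in fact equality holds, but only
this inequality is used). [cite: AndrewsForbes2022, Thm. 5.4 (proof)] -/
theorem finrank_partialSpaceLE_map_le (K : Type*) [Field K] [Algebra F K] (d : ℕ)
    (f : MvPolynomial σ F) :
    Module.finrank K (partialSpaceLE d (MvPolynomial.map (algebraMap F K) f)) ≤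
      Module.finrank F (partialSpaceLE d f) := by
  classical
  haveI := finiteDimensional_partialSpaceLE d f
  set b := Module.finBasis F (partialSpaceLE d f)
  have hle : partialSpaceLE d (MvPolynomial.map (algebraMap F K) f) ≤
      Submodule.span K (Set.range fun k =>
        MvPolynomial.map (algebraMap F K) ((b k : partialSpaceLE d f) : MvPolynomial σ F)) := by
    refine Submodule.span_le.2 ?_
    rintro _ ⟨a, ha, rfl⟩
    change mvHasseDeriv a (MvPolynomial.map (algebraMap F K) f) ∈ _
    rw [mvHasseDeriv_map]
    have hx : mvHasseDeriv a f ∈ partialSpaceLE d f := Submodule.subset_span ⟨a, ha, rfl⟩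
    have hrepr := congrArg Subtype.val (b.sum_repr ⟨mvHasseDeriv a f, hx⟩)
    simp only [Submodule.coe_sum, Submodule.coe_smul] at hrepr
    rw [← hrepr, map_sum]
    refine Submodule.sum_mem _ fun k _ => ?_
    rw [smul_eq_C_mul, map_mul, map_C, ← smul_eq_C_mul]
    exact Submodule.smul_mem _ _ (Submodule.subset_span ⟨k, rfl⟩)
  haveI := FiniteDimensional.span_of_finite K (Set.finite_range fun k =>
    MvPolynomial.map (algebraMap F K) ((b k : partialSpaceLE d f) : MvPolynomial σ F))
  refine (Submodule.finrank_mono hle).trans ?_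
  exact (finrank_range_le_card _).trans (by rw [Fintype.card_fin])

/-- Extension of scalars `F → K` can only DECREASE `dim ∂_{<∞}` as computed over the larger field.
[cite: AndrewsForbes2022, Thm. 5.4 (proof)] -/
theorem finrank_partialSpace_map_le (K : Type*) [Field K] [Algebra F K] (f : MvPolynomial σ F) :
    Module.finrank K (partialSpace (MvPolynomial.map (algebraMap F K) f)) ≤
      Module.finrank F (partialSpace f) := by
  classical
  haveI := finiteDimensional_partialSpace f
  set b := Module.finBasis F (partialSpace f)
  have hle : partialSpace (MvPolynomial.map (algebraMap F K) f) ≤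
      Submodule.span K (Set.range fun k =>
        MvPolynomial.map (algebraMap F K) ((b k : partialSpace f) : MvPolynomial σ F)) := by
    refine Submodule.span_le.2 ?_
    rintro _ ⟨a, rfl⟩
    change mvHasseDeriv a (MvPolynomial.map (algebraMap F K) f) ∈ _
    rw [mvHasseDeriv_map]
    have hx : mvHasseDeriv a f ∈ partialSpace f := Submodule.subset_span ⟨a, rfl⟩
    have hrepr := congrArg Subtype.val (b.sum_repr ⟨mvHasseDeriv a f, hx⟩)
    simp only [Submodule.coe_sum, Submodule.coe_smul] at hrepr
    rw [← hrepr, map_sum]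
    refine Submodule.sum_mem _ fun k _ => ?_
    rw [smul_eq_C_mul, map_mul, map_C, ← smul_eq_C_mul]
    exact Submodule.smul_mem _ _ (Submodule.subset_span ⟨k, rfl⟩)
  haveI := FiniteDimensional.span_of_finite K (Set.finite_range fun k =>
    MvPolynomial.map (algebraMap F K) ((b k : partialSpace f) : MvPolynomial σ F))
  refine (Submodule.finrank_mono hle).trans ?_
  exact (finrank_range_le_card _).trans (by rw [Fintype.card_fin])

end HasseMore

/-! ## The determinantal ideal and `(K_σ | K_σ)` under extension of scalars -/

section DetIdealMap

variable {F K : Type*} [Field F] [Field K] (φ : F →+* K) {n m : ℕ}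

/-- A row minor is defined over `ℤ`: it commutes with extension of scalars.
[cite: AndrewsForbes2022, Def. 2.23] -/
theorem map_rowMinor (ρ : BitableauRow n m) :
    MvPolynomial.map φ (rowMinor F ρ) = rowMinor K ρ := by
  rw [rowMinor, rowMinor, RingHom.map_det]
  congr 1
  ext i j
  simp [Matrix.submatrix_apply, Matrix.mvPolynomialX_apply, map_X]

/-- Bideterminants commute with extension of scalars. [cite: AndrewsForbes2022, Def. 2.23] -/
theorem map_bideterminant (B : Bitableau n m) :
    MvPolynomial.map φ (bideterminant F B) = bideterminant K B := by
  induction B with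
  | nil => simp [bideterminant_nil]
  | cons ρ B ih => rw [bideterminant_cons, bideterminant_cons, map_mul, map_rowMinor, ih]

/-- `I^det_{n,m,r}` is defined over `ℤ`: extension of scalars maps it into itself (a local copy of
the tree's `map_mem_detIdeal` of `DeterminantalIdealComplexityDescent.lean`, not imported here to keep
the dependency cone small). [cite: AndrewsForbes2022, §2 (Preliminaries)] -/
private theorem map_mem_detIdeal_base {r : ℕ} {f : MvPolynomial (Fin n × Fin m) F} (hf : f ∈ detIdeal F n m r) :
    MvPolynomial.map φ f ∈ detIdeal K n m r := by
  have h := Ideal.mem_map_of_mem (MvPolynomial.map φ) hf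
  rw [detIdeal, Ideal.map_span] at h
  refine (Ideal.span_le.2 ?_) h
  rintro _ ⟨p, ⟨ρ, γ, rfl⟩, rfl⟩
  refine Ideal.subset_span ⟨ρ, γ, ?_⟩
  change MvPolynomial.map φ _ = _
  rw [RingHom.map_det]
  congr 1
  ext i j
  simp [Matrix.submatrix_apply, Matrix.mvPolynomialX_apply, map_X]

/-- A row minor with distinct indices is nonzero (its monomial of the identity permutation has
coefficient `1`). [cite: AndrewsForbes2022, Lemma 5.1] -/
theorem rowMinor_ne_zero (ρ : BitableauRow n m) (hr : Function.Injective ρ.2.1)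
    (hc : Function.Injective ρ.2.2) : rowMinor F ρ ≠ 0 := by
  intro h
  have h1 := coeff_rowMono_rowMinor (F := F) ρ hr hc 1
  rw [h, coeff_zero] at h1
  exact sign_cast_ne_zero (F := F) 1 h1.symm

/-- A bideterminant all of whose rows have distinct indices is nonzero.
[cite: AndrewsForbes2022, Lemma 5.1] -/
theorem bideterminant_ne_zero (B : Bitableau n m)
    (hB : ∀ ρ ∈ B, Function.Injective ρ.2.1 ∧ Function.Injective ρ.2.2) :
    bideterminant F B ≠ 0 := by
  induction B with
  | nil => simp [bideterminant_nil]
  | cons ρ B ih =>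
    rw [bideterminant_cons]
    exact mul_ne_zero (rowMinor_ne_zero ρ (hB ρ (by simp)).1 (hB ρ (by simp)).2)
      (ih fun ρ' hρ' => hB ρ' (by simp [hρ']))

/-- `(K_σ | K_σ)` as a bideterminant in the sense of Def. 2.23: the bitableau with rows
`((1,…,s), (1,…,s))`, `s` ranging over the parts of `σ` (§3.1 p. 19).
[cite: AndrewsForbes2022, §3.1 and Def. 2.23] -/
theorem exists_bitableau_kBideterminant (σ : Multiset ℕ) (hσ : ∀ s ∈ σ, 0 < s ∧ s ≤ min n m) :
    ∃ B : Bitableau n m, bideterminant F B = kBideterminant F n m σ ∧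
      (∀ ρ ∈ B, Function.Injective ρ.2.1 ∧ Function.Injective ρ.2.2) ∧
      (∀ s ∈ σ, ∃ ρ ∈ B, ρ.1 = s) := by
  induction σ using Multiset.induction_on with
  | empty => exact ⟨[], by simp [bideterminant_nil], by simp, by simp⟩
  | cons s σ ih =>
    obtain ⟨B, hB, hinj, hrows⟩ := ih fun s' hs' => hσ s' (Multiset.mem_cons_of_mem hs')
    obtain ⟨-, hs⟩ := hσ s (Multiset.mem_cons_self s σ)
    have hn : s ≤ n := hs.trans (Nat.min_le_left n m)
    have hm : s ≤ m := hs.trans (Nat.min_le_right n m)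
    refine ⟨⟨s, Fin.castLE hn, Fin.castLE hm⟩ :: B, ?_, ?_, ?_⟩
    · rw [bideterminant_cons, kBideterminant_cons, hB, leadingMinor_of_le hn hm]
      rfl
    · intro ρ hρ
      rcases List.mem_cons.1 hρ with rfl | hρ
      · exact ⟨Fin.castLE_injective hn, Fin.castLE_injective hm⟩
      · exact hinj ρ hρ
    · intro s' hs'
      rcases Multiset.mem_cons.1 hs' with rfl | hs'
      · exact ⟨_, List.mem_cons.2 (Or.inl rfl), rfl⟩
      · obtain ⟨ρ, hρ, h⟩ := hrows s' hs'
        exact ⟨ρ, List.mem_cons.2 (Or.inr hρ), h⟩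

end DetIdealMap

/-! ## `ε`-orders in `F((ε))`: leading coefficients and reduction of a dependency modulo `ε` -/

section Orders

variable {F : Type*} [Field F]

/-- Leading term of a product: if `x = O(ε^k)` and `y = O(ε^l)` then the `ε^{k+l}`-coefficient of
`x y` is `x_k y_l`. [cite: AndrewsForbes2022, Def. 2.1] -/
theorem coeff_mul_of_isOrdGE {k l : ℤ} {x y : LaurentSeries F} (hx : IsOrdGE k x)
    (hy : IsOrdGE l y) : (x * y).coeff (k + l) = x.coeff k * y.coeff l := by
  classical
  rw [HahnSeries.coeff_mul]
  rw [Finset.sum_eq_single (k, l)]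
  · rintro ⟨i, j⟩ hp hne
    rw [Finset.mem_antidiagonal] at hp
    obtain ⟨hi, hj, hsum⟩ := hp
    rw [HahnSeries.mem_support] at hi hj
    have hik : k ≤ i := by
      by_contra h
      exact hi (hx i (by omega))
    have hjl : l ≤ j := by
      by_contra h
      exact hj (hy j (by omega))
    exfalso
    apply hne
    simp only at hsum
    exact Prod.ext (by simp; omega) (by simp; omega)
  · intro h
    rw [Finset.mem_antidiagonal, not_and, not_and] at h
    by_cases hk : x.coeff k = 0
    · rw [hk, zero_mul]
    · by_cases hl : y.coeff l = 0
      · rw [hl, mul_zero]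
      · exact (h ((HahnSeries.mem_support _ _).2 hk) ((HahnSeries.mem_support _ _).2 hl) rfl).elim

/-- An element of `F((ε))` is `O(ε^{ord})` for its own order. [folklore] -/
private theorem isOrdGE_order (x : LaurentSeries F) : IsOrdGE x.order x :=
  fun _ hi => HahnSeries.coeff_eq_zero_of_lt_order hi

/-- **Reduction of a linear dependency modulo `ε`** ("This implies that
`dim ∂_{<∞}(g(X, ε)) ≥ binom(2r, r)`", p0030:L117): let `v` be a family over `F` with own monomials
(`coeff_{μᵢ} vⱼ = 0` for `j ≠ i`, `≠ 0` for `j = i`), and `w` a family over `F(ε)` congruent to `v`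
coefficientwise modulo `ε`. Then `w` is linearly independent over `F(ε)`: a dependency, normalised to
have minimal `ε`-order `N`, has a nonzero `ε^N`-coefficient at the own monomial of the minimiser.
[cite: AndrewsForbes2022, Thm. 5.4 (proof)] -/
theorem linearIndependent_of_isOrdGE_sub {σ ι : Type*} (v : ι → MvPolynomial σ F)
    (μ : ι → σ →₀ ℕ) (hown : ∀ i, coeff (μ i) (v i) ≠ 0)
    (hoff : ∀ i j, i ≠ j → coeff (μ i) (v j) = 0) (w : ι → MvPolynomial σ (RatFunc F))
    (hw : ∀ i e, IsOrdGE 1 (algebraMap (RatFunc F) (LaurentSeries F)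
      (coeff e (w i) - algebraMap F (RatFunc F) (coeff e (v i))))) :
    LinearIndependent (RatFunc F) w := by
  classical
  rw [linearIndependent_iff']
  intro s c hsum
  by_contra hne
  push Not at hne
  obtain ⟨i₁, hi₁, hci₁⟩ := hne
  -- the minimiser of the `ε`-order among the nonzero coefficients
  set T := s.filter fun j => c j ≠ 0 with hT
  have hTne : T.Nonempty := ⟨i₁, Finset.mem_filter.2 ⟨hi₁, hci₁⟩⟩
  obtain ⟨j₀, hj₀T, hj₀min⟩ := Finset.exists_min_image T
    (fun j => (algebraMap (RatFunc F) (LaurentSeries F) (c j)).order) hTne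
  obtain ⟨hj₀s, hcj₀⟩ := Finset.mem_filter.1 hj₀T
  set N := (algebraMap (RatFunc F) (LaurentSeries F) (c j₀)).order with hN
  have hinj : Function.Injective (algebraMap (RatFunc F) (LaurentSeries F)) :=
    (algebraMap (RatFunc F) (LaurentSeries F)).injective
  have hordc : ∀ j ∈ s, IsOrdGE N (algebraMap (RatFunc F) (LaurentSeries F) (c j)) := by
    intro j hj
    by_cases hcj : c j = 0
    · rw [hcj, map_zero]; exact IsOrdGE.zero N
    · have := hj₀min j (Finset.mem_filter.2 ⟨hj, hcj⟩)
      exact (isOrdGE_order _).mono this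
  -- the own-monomial coefficient of the dependency
  have hμ := congrArg (fun p => algebraMap (RatFunc F) (LaurentSeries F) (coeff (μ j₀) p)) hsum
  simp only [coeff_sum, coeff_smul, smul_eq_mul, coeff_zero, map_sum, map_mul, map_zero] at hμ
  have hcoeffN := congrArg (fun x : LaurentSeries F => x.coeff N) hμ
  simp only [HahnSeries.coeff_sum, HahnSeries.coeff_zero] at hcoeffN
  rw [Finset.sum_eq_single_of_mem j₀ hj₀s] at hcoeffN
  · -- the `j₀` term: `c_{j₀}` times a unit of `F⟦ε⟧`
    set X := algebraMap (RatFunc F) (LaurentSeries F) (c j₀) with hX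
    have hX0 : X ≠ 0 := fun h => hcj₀ (hinj (by rw [map_zero]; exact h))
    have hXN : X.coeff N ≠ 0 := fun h => hX0 (HahnSeries.coeff_order_eq_zero.1 h)
    set D := algebraMap (RatFunc F) (LaurentSeries F)
        (coeff (μ j₀) (w j₀) - algebraMap F (RatFunc F) (coeff (μ j₀) (v j₀))) with hD
    have hD1 : IsOrdGE 1 D := hw j₀ (μ j₀)
    have hY : algebraMap (RatFunc F) (LaurentSeries F) (coeff (μ j₀) (w j₀)) =
        D + HahnSeries.C (coeff (μ j₀) (v j₀)) := by
      rw [hD, map_sub, ← coe_ratFunc_algebraMap, sub_add_cancel]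
    have h1 : (X * D).coeff N = 0 := by
      have := (hordc j₀ hj₀s).mul hD1
      exact this N (by omega)
    have h2 : (X * HahnSeries.C (coeff (μ j₀) (v j₀))).coeff N =
        coeff (μ j₀) (v j₀) * X.coeff N := by
      rw [mul_comm, HahnSeries.C_mul_eq_smul, HahnSeries.coeff_smul, smul_eq_mul]
    rw [hY, mul_add, HahnSeries.coeff_add, h1, h2, zero_add] at hcoeffN
    exact mul_ne_zero (hown j₀) hXN hcoeffN
  · intro j hj hne'
    have h1 : IsOrdGE 1 (algebraMap (RatFunc F) (LaurentSeries F) (coeff (μ j₀) (w j))) := by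
      have := hw j (μ j₀)
      rwa [hoff j₀ j (Ne.symm hne'), map_zero, sub_zero] at this
    have h2 := (hordc j hj).mul h1
    exact h2 N (by omega)

end Orders

/-! ## Own monomials of the Prop. 5.3 families -/

section Own

variable {L : Type*} [Field L] {n m : ℕ}

/-- Distinct members of the family `∂/∂x_{R,C} (S|T)` of Prop. 5.3 have DISJOINT supports (their
multidegrees differ, proof of Prop. 5.3, p0030:L78–L100). [cite: AndrewsForbes2022, Prop. 5.3 (proof)] -/
theorem eq_of_mem_support_hasseIdx_family (B : Bitableau n m) (hB0 : bideterminant L B ≠ 0)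
    {ρ₀ : BitableauRow n m} (hρ₀ : ρ₀ ∈ B) {N : ℕ} {i j : Σ k : Fin N, PairIdx ρ₀.1 k}
    {μ : Fin n × Fin m →₀ ℕ}
    (hi : μ ∈ (mvHasseDeriv (hasseIdx B (pairMatching ρ₀ i.2)) (bideterminant L B)).support)
    (hj : μ ∈ (mvHasseDeriv (hasseIdx B (pairMatching ρ₀ j.2)) (bideterminant L B)).support) :
    i = j := by
  classical
  obtain ⟨hr₀, hc₀⟩ := injective_of_bideterminant_ne_zero L B hB0 ρ₀ hρ₀
  obtain ⟨hri, hci⟩ :=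
    multideg_of_mem_support_bideterminant L B (add_mem_support_of_mem_support_mvHasseDeriv hi)
  obtain ⟨hrj, hcj⟩ :=
    multideg_of_mem_support_bideterminant L B (add_mem_support_of_mem_support_mvHasseDeriv hj)
  rw [map_add] at hri hci hrj hcj
  have hr : rowDeg (hasseIdx B (pairMatching ρ₀ i.2)) = rowDeg (hasseIdx B (pairMatching ρ₀ j.2)) :=
    add_left_cancel (hri.trans hrj.symm)
  have hc : colDeg (hasseIdx B (pairMatching ρ₀ i.2)) = colDeg (hasseIdx B (pairMatching ρ₀ j.2)) :=
    add_left_cancel (hci.trans hcj.symm)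
  apply sigma_pairIdx_ext
  · ext u
    rw [mem_iff_rowDeg_hasseIdx_ne_zero B hρ₀ hr₀ i.2 u, mem_iff_rowDeg_hasseIdx_ne_zero B hρ₀ hr₀ j.2 u,
      hr]
  · ext v
    rw [mem_iff_colDeg_hasseIdx_ne_zero B hρ₀ hc₀ i.2 v, mem_iff_colDeg_hasseIdx_ne_zero B hρ₀ hc₀ j.2 v,
      hc]

/-- Distinct members of the first-order family `∏ᵢ ∂/∂x_{rᵢ,cᵢ} (S|T)` of Prop. 5.3 (char. 0) have
disjoint supports. [cite: AndrewsForbes2022, Prop. 5.3 (proof, char. 0)] -/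
theorem eq_of_mem_support_sqfree_family (B : Bitableau n m) (hB0 : bideterminant L B ≠ 0)
    {ρ₀ : BitableauRow n m} (hρ₀ : ρ₀ ∈ B) {N : ℕ} {i j : Σ k : Fin N, PairIdx ρ₀.1 k}
    {μ : Fin n × Fin m →₀ ℕ}
    (hi : μ ∈ (mvHasseDeriv (sqfree (pairMatching ρ₀ i.2)) (bideterminant L B)).support)
    (hj : μ ∈ (mvHasseDeriv (sqfree (pairMatching ρ₀ j.2)) (bideterminant L B)).support) :
    i = j := by
  classical
  obtain ⟨hr₀, hc₀⟩ := injective_of_bideterminant_ne_zero L B hB0 ρ₀ hρ₀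
  obtain ⟨hri, hci⟩ :=
    multideg_of_mem_support_bideterminant L B (add_mem_support_of_mem_support_mvHasseDeriv hi)
  obtain ⟨hrj, hcj⟩ :=
    multideg_of_mem_support_bideterminant L B (add_mem_support_of_mem_support_mvHasseDeriv hj)
  rw [map_add] at hri hci hrj hcj
  have hr : rowDeg (sqfree (pairMatching ρ₀ i.2)) = rowDeg (sqfree (pairMatching ρ₀ j.2)) :=
    add_left_cancel (hri.trans hrj.symm)
  have hc : colDeg (sqfree (pairMatching ρ₀ i.2)) = colDeg (sqfree (pairMatching ρ₀ j.2)) :=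
    add_left_cancel (hci.trans hcj.symm)
  apply sigma_pairIdx_ext
  · ext u
    rw [← exists_fst_eq_iff hr₀ i.2 u, ← exists_fst_eq_iff hr₀ j.2 u,
      ← rowDeg_sqfree_apply_ne_zero_iff, ← rowDeg_sqfree_apply_ne_zero_iff, hr]
  · ext v
    rw [← exists_snd_eq_iff hc₀ i.2 v, ← exists_snd_eq_iff hc₀ j.2 v,
      ← colDeg_sqfree_apply_ne_zero_iff, ← colDeg_sqfree_apply_ne_zero_iff, hc]

/-- Own monomials for the family `α · ∂/∂x_{R,C} (K_σ|K_σ)` ("the elements of `D` are nonzero … of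
distinct multidegree"). [cite: AndrewsForbes2022, Prop. 5.3 (proof)] -/
theorem exists_own_monomials_hasseIdx (B : Bitableau n m)
    (hB : ∀ ρ ∈ B, Function.Injective ρ.2.1 ∧ Function.Injective ρ.2.2)
    {ρ₀ : BitableauRow n m} (hρ₀ : ρ₀ ∈ B) (N : ℕ) {α : L} (hα : α ≠ 0) :
    ∃ μ : (Σ k : Fin N, PairIdx ρ₀.1 k) → (Fin n × Fin m →₀ ℕ),
      (∀ i, coeff (μ i)
        (C α * mvHasseDeriv (hasseIdx B (pairMatching ρ₀ i.2)) (bideterminant L B)) ≠ 0) ∧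
      (∀ i j, i ≠ j → coeff (μ i)
        (C α * mvHasseDeriv (hasseIdx B (pairMatching ρ₀ j.2)) (bideterminant L B)) = 0) := by
  classical
  have hB0 : bideterminant L B ≠ 0 := bideterminant_ne_zero B hB
  obtain ⟨hr₀, hc₀⟩ := hB ρ₀ hρ₀
  have hne : ∀ i : Σ k : Fin N, PairIdx ρ₀.1 k,
      mvHasseDeriv (hasseIdx B (pairMatching ρ₀ i.2)) (bideterminant L B) ≠ 0 := fun i =>
    mvHasseDeriv_hasseIdx_bideterminant_ne_zero L B hB (pairMatching ρ₀ i.2)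
      (injOn_fst_pairMatching hr₀ i.2) (injOn_snd_pairMatching hc₀ i.2)
  choose μ hμ using fun i => MvPolynomial.ne_zero_iff.1 (hne i)
  refine ⟨μ, fun i => ?_, fun i j hij => ?_⟩
  · rw [coeff_C_mul]
    exact mul_ne_zero hα (hμ i)
  · rw [coeff_C_mul]
    by_cases h0 : coeff (μ i) (mvHasseDeriv (hasseIdx B (pairMatching ρ₀ j.2)) (bideterminant L B)) = 0
    · rw [h0, mul_zero]
    · exact (hij (eq_of_mem_support_hasseIdx_family B hB0 hρ₀ (mem_support_iff.2 (hμ i))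
        (mem_support_iff.2 h0))).elim

/-- Own monomials for the first-order family `α · ∏ᵢ ∂/∂x_{rᵢ,cᵢ} (K_σ|K_σ)` (characteristic zero).
[cite: AndrewsForbes2022, Prop. 5.3 (proof, char. 0)] -/
theorem exists_own_monomials_sqfree [CharZero L] (B : Bitableau n m)
    (hB : ∀ ρ ∈ B, Function.Injective ρ.2.1 ∧ Function.Injective ρ.2.2)
    {ρ₀ : BitableauRow n m} (hρ₀ : ρ₀ ∈ B) (N : ℕ) {α : L} (hα : α ≠ 0) :
    ∃ μ : (Σ k : Fin N, PairIdx ρ₀.1 k) → (Fin n × Fin m →₀ ℕ),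
      (∀ i, coeff (μ i)
        (C α * mvHasseDeriv (sqfree (pairMatching ρ₀ i.2)) (bideterminant L B)) ≠ 0) ∧
      (∀ i j, i ≠ j → coeff (μ i)
        (C α * mvHasseDeriv (sqfree (pairMatching ρ₀ j.2)) (bideterminant L B)) = 0) := by
  classical
  have hB0 : bideterminant L B ≠ 0 := bideterminant_ne_zero B hB
  obtain ⟨hr₀, hc₀⟩ := hB ρ₀ hρ₀
  have hne : ∀ i : Σ k : Fin N, PairIdx ρ₀.1 k,
      mvHasseDeriv (sqfree (pairMatching ρ₀ i.2)) (bideterminant L B) ≠ 0 := fun i =>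
    mvHasseDeriv_sqfree_bideterminant_ne_zero L B hB (pairMatching ρ₀ i.2)
      (injOn_fst_pairMatching hr₀ i.2) (injOn_snd_pairMatching hc₀ i.2)
      (sqfree_pairMatching_le_hasseIdx B hρ₀ i.2)
  choose μ hμ using fun i => MvPolynomial.ne_zero_iff.1 (hne i)
  refine ⟨μ, fun i => ?_, fun i j hij => ?_⟩
  · rw [coeff_C_mul]
    exact mul_ne_zero hα (hμ i)
  · rw [coeff_C_mul]
    by_cases h0 : coeff (μ i) (mvHasseDeriv (sqfree (pairMatching ρ₀ j.2)) (bideterminant L B)) = 0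
    · rw [h0, mul_zero]
    · exact (hij (eq_of_mem_support_sqfree_family B hB0 hρ₀ (mem_support_iff.2 (hμ i))
        (mem_support_iff.2 h0))).elim

end Own

/-! ## Assembly: Theorem 5.4 -/

section Assembly

/-- The central binomial coefficients increase: `binom(2r, r) ≤ binom(2s, s)` for `r ≤ s` (the step
"`binom(2σ₁, σ₁) ≥ binom(2r, r)`", p0030:L116). [cite: AndrewsForbes2022, Thm. 5.4 (proof)] -/
theorem choose_two_mul_self_mono {r s : ℕ} (h : r ≤ s) : (2 * r).choose r ≤ (2 * s).choose s := by
  induction s, h using Nat.le_induction with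
  | base => exact le_rfl
  | succ k _ ih =>
    refine ih.trans ?_
    rw [← Nat.centralBinom_eq_two_mul_choose, ← Nat.centralBinom_eq_two_mul_choose]
    have h1 := Nat.succ_mul_centralBinom_succ k
    have h2 : (k + 1) * Nat.centralBinom k ≤ (k + 1) * Nat.centralBinom (k + 1) := by
      rw [h1]
      exact Nat.mul_le_mul_right _ (by omega)
    exact Nat.le_of_mul_le_mul_left h2 (Nat.succ_pos k)

/-- The substitution of Prop. 3.5, `x_{i,j} ↦ Σ_{k,l} c_{(i,j),(k,l)} x_{k,l}` applied to `f` over the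
small field, is t24's `linSubst c` applied to `f ⊗ F(ε)`. [cite: AndrewsForbes2022, Prop. 3.5] -/
theorem aeval_eq_linSubst_map {L K : Type*} [Field L] [Field K] [Algebra L K] {τ : Type*}
    [Fintype τ] (c : Matrix τ τ K) (p : MvPolynomial τ L) :
    MvPolynomial.aeval (fun i => ∑ j, C (c i j) * X j) p =
      Lemma220.linSubst c (MvPolynomial.map (algebraMap L K) p) := by
  have h : (fun i => ∑ j, C (c i j) * X j : τ → MvPolynomial τ K) = fun i => ∑ j, c i j • X j := by
    funext i
    simp [smul_eq_C_mul]
  rw [Lemma220.linSubst, MvPolynomial.aeval_map_algebraMap K, h]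

/-- `F(t)` is infinite. [folklore] -/
private theorem infinite_ratFunc (F : Type*) [Field F] : Infinite (RatFunc F) :=
  Infinite.of_injective _ (IsFractionRing.injective (Polynomial F) (RatFunc F))

/-- A multiset with `r ≤ sup` and `0 < r` has a part `≥ r`. [folklore] -/
private theorem exists_mem_ge_of_le_sup {σ : Multiset ℕ} {r : ℕ} (hr : 0 < r) (h : r ≤ σ.sup) :
    ∃ s ∈ σ, r ≤ s := by
  by_contra hcon
  push Not at hcon
  have : σ.sup ≤ r - 1 := Multiset.sup_le.2 fun b hb => by have := hcon b hb; omega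
  omega

/-- From the `O(ε^{q+1})`-statement of Prop. 3.5 to "`g(X, ε) = α (K_σ|K_σ)(X) + O(ε)`"
coefficientwise, `g = ε^{-q} f(ℓ)` (p0030:L113). [cite: AndrewsForbes2022, Thm. 5.4 (proof)] -/
theorem isOrdGE_one_coeff_of_prop35 {L : Type*} [Field L] {τ : Type*}
    (G : MvPolynomial τ (RatFunc L)) (P kB : MvPolynomial τ L) (q : ℤ) (α : L) (hkB : P = kB)
    (hO : ∀ e : τ →₀ ℕ, IsBigOEps L (q + 1) (coeff e
      (G - C (RatFunc.X ^ q * algebraMap L (RatFunc L) α) *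
        MvPolynomial.map (algebraMap L (RatFunc L)) kB)))
    (e : τ →₀ ℕ) :
    IsOrdGE 1 (algebraMap (RatFunc L) (LaurentSeries L)
      (coeff e (C (RatFunc.X ^ (-q)) * G) - algebraMap L (RatFunc L) (α * coeff e P))) := by
  have h := (isBigOEps_iff_isOrdGE _ _).1 (hO e)
  rw [coeff_sub, coeff_C_mul, coeff_map] at h
  have hX : (RatFunc.X : RatFunc L) ^ q ≠ 0 := zpow_ne_zero q RatFunc.X_ne_zero
  have hrew : coeff e (C (RatFunc.X ^ (-q)) * G) - algebraMap L (RatFunc L) (α * coeff e P) =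
      RatFunc.X ^ (-q) * (coeff e G - RatFunc.X ^ q * algebraMap L (RatFunc L) α *
        algebraMap L (RatFunc L) (coeff e kB)) := by
    rw [coeff_C_mul, hkB, map_mul, mul_sub, ← mul_assoc, ← mul_assoc, zpow_neg,
      inv_mul_cancel₀ hX, one_mul]
  rw [hrew, map_mul]
  have hz : algebraMap (RatFunc L) (LaurentSeries L) (RatFunc.X ^ (-q)) =
      HahnSeries.single (-q) 1 := coe_ratFunc_X_zpow (-q)
  rw [hz]
  have := h.single_mul (-q) 1
  rwa [show -q + (q + 1) = 1 by ring] at this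

/-- The perturbation hypothesis for a Hasse derivative: if `g ≡ α·b (mod ε)` coefficientwise then
`∂/∂x^a g ≡ ∂/∂x^a (α b) (mod ε)` coefficientwise (Lemma 2.14 has integer coefficients).
[cite: AndrewsForbes2022, Thm. 5.4 (proof)] -/
theorem isOrdGE_one_coeff_mvHasseDeriv {L : Type*} [Field L] {τ : Type*}
    (g : MvPolynomial τ (RatFunc L)) (b : MvPolynomial τ L) (α : L)
    (hg : ∀ e : τ →₀ ℕ, IsOrdGE 1 (algebraMap (RatFunc L) (LaurentSeries L)
      (coeff e g - algebraMap L (RatFunc L) (α * coeff e b))))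
    (a e : τ →₀ ℕ) :
    IsOrdGE 1 (algebraMap (RatFunc L) (LaurentSeries L)
      (coeff e (mvHasseDeriv a g) - algebraMap L (RatFunc L) (coeff e (C α * mvHasseDeriv a b)))) := by
  rw [coeff_mvHasseDeriv, coeff_C_mul, coeff_mvHasseDeriv]
  set P : L := a.prod fun i k => (((e + a) i).choose k : L) with hP
  have hPK : (a.prod fun i k => (((e + a) i).choose k : RatFunc L)) = algebraMap L (RatFunc L) P := by
    rw [hP, Finsupp.prod, Finsupp.prod, map_prod]
    simp only [map_natCast]
  rw [hPK]
  have hrew : algebraMap L (RatFunc L) P * coeff (e + a) g -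
      algebraMap L (RatFunc L) (α * (P * coeff (e + a) b)) =
      algebraMap L (RatFunc L) P *
        (coeff (e + a) g - algebraMap L (RatFunc L) (α * coeff (e + a) b)) := by
    rw [map_mul, map_mul, map_mul]
    ring
  rw [hrew, map_mul]
  have h0 : IsOrdGE 0 (algebraMap (RatFunc L) (LaurentSeries L) (algebraMap L (RatFunc L) P)) := by
    rw [← RingHom.comp_apply, algebraMap_ratFunc_comp_algebraMap, algebraMap_laurentSeries_apply]
    exact IsOrdGE.C P
  have := h0.mul (hg (e + a))
  rwa [zero_add] at this

/-- **Theorem 5.4, first part, over every field**: a nonzero `f ∈ I^det_{n,m,r}` has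
`binom(2r, r) ≤ dim ∂_{<∞}(f)`. [cite: AndrewsForbes2022, Thm. 5.4] -/
theorem choose_le_finrank_partialSpace_of_mem_detIdeal (F : Type) [Field F] (n m r : ℕ)
    (f : MvPolynomial (Fin n × Fin m) F) (hf : f ∈ detIdeal F n m r) (hf0 : f ≠ 0) :
    (2 * r).choose r ≤ Module.finrank F (partialSpace f) := by
  classical
  haveI := finiteDimensional_partialSpace f
  rcases Nat.eq_zero_or_pos r with rfl | hr
  · rw [Nat.choose_zero_right]
    exact Module.finrank_pos_iff_exists_ne_zero.2
      ⟨⟨f, self_mem_partialSpace f⟩, fun h => hf0 (congrArg Subtype.val h)⟩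
  -- extension of scalars to the infinite field `L = F(t)`
  haveI : Infinite (RatFunc F) := infinite_ratFunc F
  set fL := MvPolynomial.map (algebraMap F (RatFunc F)) f with hfL
  have hfL0 : fL ≠ 0 := fun h => hf0 (MvPolynomial.map_injective _
    (algebraMap F (RatFunc F)).injective (by rw [← hfL, h, map_zero]))
  have hfLmem : fL ∈ detIdeal (RatFunc F) n m r := map_mem_detIdeal_base _ hf
  -- Prop. 3.5 over `L`
  obtain ⟨c, q, α, σ, hc, hα, hσr, hσ, hO⟩ :=
    AndrewsForbes2022_prop_3_5_of_infinite (RatFunc F) n m r hr fL hfLmem hfL0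
  obtain ⟨Bσ, hBσ, hBinj, hBrows⟩ := exists_bitableau_kBideterminant (F := RatFunc F) σ hσ
  obtain ⟨s₁, hs₁σ, hrs₁⟩ := exists_mem_ge_of_le_sup hr hσr
  obtain ⟨ρ₀, hρ₀, hρ₀s⟩ := hBrows s₁ hs₁σ
  -- `g(X, ε) = ε^{-q} f(ℓ(X, ε)) = α (K_σ|K_σ) + O(ε)`
  set G := MvPolynomial.aeval
    (fun ij : Fin n × Fin m => ∑ kl : Fin n × Fin m, C (c ij kl) * X kl) fL with hG
  set g := C (RatFunc.X ^ (-q)) * G with hg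
  have hpert : ∀ e, IsOrdGE 1 (algebraMap (RatFunc (RatFunc F)) (LaurentSeries (RatFunc F))
      (coeff e g - algebraMap (RatFunc F) (RatFunc (RatFunc F))
        (α * coeff e (bideterminant (RatFunc F) Bσ)))) :=
    isOrdGE_one_coeff_of_prop35 G _ _ q α hBσ hO
  -- the Prop. 5.3 family of `α (K_σ|K_σ)` over `L` and its own monomials
  obtain ⟨μ, hown, hoff⟩ :=
    exists_own_monomials_hasseIdx Bσ hBinj hρ₀ (ρ₀.1 + 1) hα
  -- the perturbed family over `K = L(ε)` is linearly independent
  have hli := linearIndependent_of_isOrdGE_sub _ μ hown hoff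
    (fun i : Σ k : Fin (ρ₀.1 + 1), PairIdx ρ₀.1 k =>
      mvHasseDeriv (hasseIdx Bσ (pairMatching ρ₀ i.2)) g)
    (fun i e => isOrdGE_one_coeff_mvHasseDeriv g _ α hpert _ e)
  haveI := finiteDimensional_partialSpace g
  have hli' : LinearIndependent (RatFunc (RatFunc F))
      (fun i : Σ k : Fin (ρ₀.1 + 1), PairIdx ρ₀.1 k =>
        (⟨mvHasseDeriv (hasseIdx Bσ (pairMatching ρ₀ i.2)) g, Submodule.subset_span ⟨_, rfl⟩⟩ :
          partialSpace g)) :=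
    LinearIndependent.of_comp (partialSpace g).subtype hli
  have hcard := hli'.fintype_card_le_finrank
  rw [card_sigma_pairIdx] at hcard
  -- `dim ∂(g) = dim ∂(f ⊗ K) ≤ dim ∂(f ⊗ L) ≤ dim ∂(f)`
  have h1 : Module.finrank (RatFunc (RatFunc F)) (partialSpace g) =
      Module.finrank (RatFunc (RatFunc F)) (partialSpace G) := by
    rw [hg, partialSpace_C_mul (zpow_ne_zero _ RatFunc.X_ne_zero)]
  have h2 : Module.finrank (RatFunc (RatFunc F)) (partialSpace G) =
      Module.finrank (RatFunc (RatFunc F))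
        (partialSpace (MvPolynomial.map (algebraMap (RatFunc F) (RatFunc (RatFunc F))) fL)) := by
    rw [hG, aeval_eq_linSubst_map]
    exact finrank_partialSpace_linSubst_eq c hc _
  have h3 := finrank_partialSpace_map_le (RatFunc (RatFunc F)) fL
  have h4 := finrank_partialSpace_map_le (RatFunc F) f
  calc (2 * r).choose r ≤ (2 * s₁).choose s₁ := choose_two_mul_self_mono hrs₁
    _ = (2 * ρ₀.1).choose ρ₀.1 := by rw [hρ₀s]
    _ ≤ Module.finrank (RatFunc (RatFunc F)) (partialSpace g) := hcard
    _ ≤ Module.finrank F (partialSpace f) := by rw [h1, h2]; exact h3.trans (hfL ▸ h4)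

/-- **Theorem 5.4, second part (`char F = 0`)**: a nonzero `f ∈ I^det_{n,m,r}` has
`Σ_{i ≤ d} binom(r, i)² ≤ dim ∂_{≤d}(f)`. [cite: AndrewsForbes2022, Thm. 5.4] -/
theorem sum_choose_sq_le_finrank_partialSpaceLE_of_mem_detIdeal (F : Type) [Field F] [CharZero F]
    (n m r : ℕ) (f : MvPolynomial (Fin n × Fin m) F) (hf : f ∈ detIdeal F n m r) (hf0 : f ≠ 0)
    (d : ℕ) :
    ∑ i ∈ Finset.range (d + 1), (r.choose i) ^ 2 ≤ Module.finrank F (partialSpaceLE d f) := by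
  classical
  haveI := finiteDimensional_partialSpaceLE d f
  rcases Nat.eq_zero_or_pos r with rfl | hr
  · rw [Finset.sum_range_succ', Nat.choose_zero_right, one_pow, Finset.sum_eq_zero, zero_add]
    · exact Module.finrank_pos_iff_exists_ne_zero.2
        ⟨⟨f, self_mem_partialSpaceLE d f⟩, fun h => hf0 (congrArg Subtype.val h)⟩
    · intro i _
      rw [Nat.choose_zero_succ, zero_pow two_ne_zero]
  haveI : Infinite (RatFunc F) := infinite_ratFunc F
  haveI : CharZero (RatFunc F) :=
    charZero_of_injective_algebraMap (algebraMap F (RatFunc F)).injective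
  set fL := MvPolynomial.map (algebraMap F (RatFunc F)) f with hfL
  have hfL0 : fL ≠ 0 := fun h => hf0 (MvPolynomial.map_injective _
    (algebraMap F (RatFunc F)).injective (by rw [← hfL, h, map_zero]))
  have hfLmem : fL ∈ detIdeal (RatFunc F) n m r := map_mem_detIdeal_base _ hf
  obtain ⟨c, q, α, σ, hc, hα, hσr, hσ, hO⟩ :=
    AndrewsForbes2022_prop_3_5_of_infinite (RatFunc F) n m r hr fL hfLmem hfL0
  obtain ⟨Bσ, hBσ, hBinj, hBrows⟩ := exists_bitableau_kBideterminant (F := RatFunc F) σ hσ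
  obtain ⟨s₁, hs₁σ, hrs₁⟩ := exists_mem_ge_of_le_sup hr hσr
  obtain ⟨ρ₀, hρ₀, hρ₀s⟩ := hBrows s₁ hs₁σ
  obtain ⟨hr₀, -⟩ := hBinj ρ₀ hρ₀
  set G := MvPolynomial.aeval
    (fun ij : Fin n × Fin m => ∑ kl : Fin n × Fin m, C (c ij kl) * X kl) fL with hG
  set g := C (RatFunc.X ^ (-q)) * G with hg
  have hpert : ∀ e, IsOrdGE 1 (algebraMap (RatFunc (RatFunc F)) (LaurentSeries (RatFunc F))
      (coeff e g - algebraMap (RatFunc F) (RatFunc (RatFunc F))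
        (α * coeff e (bideterminant (RatFunc F) Bσ)))) :=
    isOrdGE_one_coeff_of_prop35 G _ _ q α hBσ hO
  obtain ⟨μ, hown, hoff⟩ :=
    exists_own_monomials_sqfree Bσ hBinj hρ₀ (min ρ₀.1 d + 1) hα
  have hli := linearIndependent_of_isOrdGE_sub _ μ hown hoff
    (fun i : Σ k : Fin (min ρ₀.1 d + 1), PairIdx ρ₀.1 k =>
      mvHasseDeriv (sqfree (pairMatching ρ₀ i.2)) g)
    (fun i e => isOrdGE_one_coeff_mvHasseDeriv g _ α hpert _ e)
  haveI := finiteDimensional_partialSpaceLE d g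
  have hmem : ∀ i : Σ k : Fin (min ρ₀.1 d + 1), PairIdx ρ₀.1 k,
      mvHasseDeriv (sqfree (pairMatching ρ₀ i.2)) g ∈ partialSpaceLE d g := by
    intro i
    refine Submodule.subset_span ⟨sqfree (pairMatching ρ₀ i.2), ?_, rfl⟩
    show Finsupp.degree (sqfree (pairMatching ρ₀ i.2)) ≤ d
    rw [degree_sqfree, card_pairMatching hr₀ i.2]
    have := i.1.2
    omega
  have hli' : LinearIndependent (RatFunc (RatFunc F))
      (fun i : Σ k : Fin (min ρ₀.1 d + 1), PairIdx ρ₀.1 k =>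
        (⟨mvHasseDeriv (sqfree (pairMatching ρ₀ i.2)) g, hmem i⟩ : partialSpaceLE d g)) :=
    LinearIndependent.of_comp (partialSpaceLE d g).subtype hli
  have hcard := hli'.fintype_card_le_finrank
  rw [card_sigma_pairIdx_le] at hcard
  have h1 : Module.finrank (RatFunc (RatFunc F)) (partialSpaceLE d g) =
      Module.finrank (RatFunc (RatFunc F)) (partialSpaceLE d G) := by
    rw [hg, partialSpaceLE_C_mul (zpow_ne_zero _ RatFunc.X_ne_zero)]
  have h2 : Module.finrank (RatFunc (RatFunc F)) (partialSpaceLE d G) =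
      Module.finrank (RatFunc (RatFunc F))
        (partialSpaceLE d (MvPolynomial.map (algebraMap (RatFunc F) (RatFunc (RatFunc F))) fL)) := by
    rw [hG, aeval_eq_linSubst_map]
    exact finrank_partialSpaceLE_linSubst_eq c hc d _
  have h3 := finrank_partialSpaceLE_map_le (RatFunc (RatFunc F)) d fL
  have h4 := finrank_partialSpaceLE_map_le (RatFunc F) d f
  calc ∑ i ∈ Finset.range (d + 1), (r.choose i) ^ 2
      ≤ ∑ i ∈ Finset.range (d + 1), (s₁.choose i) ^ 2 :=
        Finset.sum_le_sum fun i _ => Nat.pow_le_pow_left (Nat.choose_le_choose i hrs₁) 2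
    _ = ∑ i ∈ Finset.range (min ρ₀.1 d + 1), (ρ₀.1.choose i) ^ 2 := by
        rw [hρ₀s, sum_range_choose_sq_eq_min]
    _ ≤ Module.finrank (RatFunc (RatFunc F)) (partialSpaceLE d g) := hcard
    _ ≤ Module.finrank F (partialSpaceLE d f) := by rw [h1, h2]; exact h3.trans (hfL ▸ h4)

/-- **Discharge of `AndrewsForbes2022_thm_5_4`** (AF22 Thm. 5.4, first part, any characteristic;
p0030:L108). [cite: AndrewsForbes2022, Thm. 5.4] -/
theorem AndrewsForbes2022_thm_5_4_holds : AndrewsForbes2022_thm_5_4 :=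
  fun F _ n m r f hf hf0 => choose_le_finrank_partialSpace_of_mem_detIdeal F n m r f hf hf0

/-- **Discharge of `AndrewsForbes2022_thm_5_4_charZero`** (AF22 Thm. 5.4, second part, `char F = 0`;
p0030:L110). [cite: AndrewsForbes2022, Thm. 5.4] -/
theorem AndrewsForbes2022_thm_5_4_charZero_holds : AndrewsForbes2022_thm_5_4_charZero :=
  fun F _ _ n m r f hf hf0 d =>
    sum_choose_sq_le_finrank_partialSpaceLE_of_mem_detIdeal F n m r f hf hf0 d

/-- **`dim ∂_{<∞}(I^det_{n,m,r}) = dim ∂_{<∞}(det_r) = binom(2r, r)`** — the displayed equation of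
§5 (p0029:L25–L27: "the naïve upper bound on `dim(∂_{<∞}(I^det_{n,m,r}))` is tight", with
`dim(∂_{<∞}(I^det_{n,m,r})) := min_{f ∈ I^det_{n,m,r} ∖ {0}} dim(∂_{<∞}(f))`, p0029:L11–L13): for
`r ≤ min(n, m)` the least value of `dim ∂_{<∞}(f)` over the nonzero `f ∈ I^det_{n,m,r}` is
`binom(2r, r)`, attained at an `r × r` minor (`finrank_partialSpace_minor`), every field.
(For `r > min(n, m)` the ideal is `0` and the printed minimum is over the empty set.)
[cite: AndrewsForbes2022, Thm. 5.4 and §5 (p. 29)] -/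
theorem isLeast_finrank_partialSpace_detIdeal (F : Type) [Field F] {n m r : ℕ} (hr : r ≤ min n m) :
    IsLeast {k | ∃ f ∈ detIdeal F n m r, f ≠ 0 ∧ Module.finrank F (partialSpace f) = k}
      ((2 * r).choose r) := by
  have hn : r ≤ n := hr.trans (min_le_left n m)
  have hm : r ≤ m := hr.trans (min_le_right n m)
  refine ⟨⟨((Matrix.mvPolynomialX (Fin n) (Fin m) F).submatrix (Fin.castLE hn) (Fin.castLE hm)).det,
    Ideal.subset_span ⟨_, _, rfl⟩,
    rowMinor_ne_zero ⟨r, Fin.castLE hn, Fin.castLE hm⟩ (Fin.castLE_injective hn)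
      (Fin.castLE_injective hm),
    finrank_partialSpace_minor (Fin.castLE_injective hn) (Fin.castLE_injective hm)⟩, ?_⟩
  rintro k ⟨f, hf, hf0, rfl⟩
  exact choose_le_finrank_partialSpace_of_mem_detIdeal F n m r f hf hf0

end Assembly

/-! ## Remark 5.5: the characteristic-zero hypothesis of Theorem 5.4's second part is needed -/

section RemarkFiveFive

variable {R : Type*} [CommSemiring R] {σ : Type*}

/-- First-order Hasse derivatives are the usual partial derivatives (Def. 2.13: "`∂/∂x^a`
agrees with the familiar partial derivative for `|a| = 1`"; Lemma 2.14 on monomials).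
[cite: AndrewsForbes2022, Def. 2.13 and Lemma 2.14] -/
theorem mvHasseDeriv_single_one [DecidableEq σ] (v : σ) (f : MvPolynomial σ R) :
    mvHasseDeriv (Finsupp.single v 1) f = pderiv v f := by
  induction f using MvPolynomial.induction_on' with
  | monomial s a =>
    rw [mvHasseDeriv_monomial, pderiv_monomial, Finsupp.prod_single_index]
    · rw [Nat.choose_one_right, mul_comm]
    · rw [Nat.choose_zero_right, Nat.cast_one]
  | add p q hp hq => rw [Lemma220.mvHasseDeriv_add, map_add, hp, hq]

/-- An exponent vector of degree `≤ 1` is `0` or a unit vector. [cite: AndrewsForbes2022, Def. 2.19] -/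
theorem eq_zero_or_eq_single_of_degree_le_one {a : σ →₀ ℕ} (ha : Finsupp.degree a ≤ 1) :
    a = 0 ∨ ∃ v, a = Finsupp.single v 1 := by
  classical
  by_cases h0 : a = 0
  · exact Or.inl h0
  · right
    obtain ⟨v, hv⟩ : a.support.Nonempty := Finsupp.support_nonempty_iff.2 h0
    have hav : a v ≠ 0 := Finsupp.mem_support_iff.1 hv
    have hdeg : Finsupp.degree a = ∑ i ∈ a.support, a i := Finsupp.degree_apply a
    have hle : a v ≤ Finsupp.degree a := by
      rw [hdeg]
      exact Finset.single_le_sum (fun i _ => Nat.zero_le (a i)) hv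
    have hav1 : a v = 1 := by omega
    have hsupp : a.support ⊆ {v} := by
      intro w hw
      rw [Finset.mem_singleton]
      by_contra hwv
      have haw : a w ≠ 0 := Finsupp.mem_support_iff.1 hw
      have h2 : a v + a w ≤ Finsupp.degree a := by
        rw [hdeg, ← Finset.sum_pair (Ne.symm hwv)]
        exact Finset.sum_le_sum_of_subset_of_nonneg
          (Finset.insert_subset hv (Finset.singleton_subset_iff.2 hw)) fun i _ _ => Nat.zero_le _
      omega
    refine ⟨v, ?_⟩
    rw [← hav1]
    exact Finsupp.support_subset_singleton.1 hsupp

variable {F : Type*} [Field F]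

/-- In characteristic `p`, all first-order partials of a `p`-th power vanish, so
`∂_{≤1}(f^p) = span{f^p}` ("`∂(f^p)/∂xᵢ = 0` for all `i`", Remark 5.5, p0031:L3).
[cite: AndrewsForbes2022, Rem. 5.5] -/
theorem partialSpaceLE_one_pow_char (p : ℕ) [CharP F p] (f : MvPolynomial σ F) :
    partialSpaceLE 1 (f ^ p) = Submodule.span F {f ^ p} := by
  classical
  refine le_antisymm (Submodule.span_le.2 ?_) (Submodule.span_le.2 ?_)
  · rintro _ ⟨a, ha, rfl⟩
    change mvHasseDeriv a (f ^ p) ∈ Submodule.span F {f ^ p}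
    rcases eq_zero_or_eq_single_of_degree_le_one ha with rfl | ⟨v, rfl⟩
    · rw [mvHasseDeriv_zero_left]
      exact Submodule.subset_span rfl
    · rw [mvHasseDeriv_single_one, (pderiv v).leibniz_pow, ← Nat.cast_smul_eq_nsmul F p,
        CharP.cast_eq_zero F p, zero_smul]
      exact Submodule.zero_mem _
  · rintro _ rfl
    exact self_mem_partialSpaceLE 1 (f ^ p)

/-- **Andrews–Forbes 2022, Remark 5.5** (p0031:L1–L3), PROVED: "The hypothesis `char F = 0` in the
second part of Thm. 5.4 cannot be avoided in general. If `char F = p > 0` and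
`f ∈ I^det_{n,m,r} ∖ {0}`, then `∂(f^p)/∂xᵢ = 0` for all `i`, so `dim ∂_{≤1}(f^p) = 1 < 1 + r²`" —
here: `f^p ∈ I^det_{n,m,r} ∖ {0}` and `dim ∂_{≤1}(f^p) = 1`, while the characteristic-zero bound of
Thm. 5.4 at `d = 1` is `Σ_{i ≤ 1} binom(r,i)² = 1 + r² > 1` once `r ≥ 1`.
[cite: AndrewsForbes2022, Rem. 5.5] -/
theorem AndrewsForbes2022_rem_5_5 (p : ℕ) [Fact p.Prime] (F : Type*) [Field F] [CharP F p]
    {n m r : ℕ} (f : MvPolynomial (Fin n × Fin m) F) (hf : f ∈ detIdeal F n m r) (hf0 : f ≠ 0) :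
    f ^ p ∈ detIdeal F n m r ∧ f ^ p ≠ 0 ∧ Module.finrank F (partialSpaceLE 1 (f ^ p)) = 1 ∧
      (1 ≤ r → 1 < ∑ i ∈ Finset.range (1 + 1), (r.choose i) ^ 2) := by
  have hp : p ≠ 0 := (Fact.out : p.Prime).ne_zero
  have hfp : f ^ p ≠ 0 := pow_ne_zero p hf0
  refine ⟨Ideal.pow_mem_of_mem _ hf p (Nat.pos_of_ne_zero hp), hfp, ?_, fun hr => ?_⟩
  · rw [partialSpaceLE_one_pow_char p f, finrank_span_singleton hfp]
  · rw [Finset.sum_range_succ, Finset.sum_range_one, Nat.choose_zero_right, Nat.choose_one_right]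
    nlinarith

end RemarkFiveFive

/-! ## The graded count `dim ∂_{≤d}(det_r) = Σ_{i≤d} binom(r,i)²` over every field, and sharpness
of both parts of Theorem 5.4 in the graded setting -/

section GradedDet

variable {K : Type*} [Field K] {n : ℕ}

/-- Canonical derivatives of one order `k ≤ d` lie in the span of those of all orders `≤ min(n,d)`
(for `k > n` there are none). [cite: AndrewsForbes2022, §5 (p. 29)] -/
theorem span_range_gen_le_span_gradedGen (c : Equiv.Perm (Fin n) → K) (d : ℕ) {k : ℕ}
    (hk : k ≤ d) :
    Submodule.span K (Set.range (gen (k := k) c)) ≤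
      Submodule.span K
        (Set.range (fun p : Σ k : Fin (min n d + 1), PairIdx n k => gen c p.2)) := by
  rcases Nat.lt_or_ge n k with hnk | hnk
  · haveI := isEmpty_pairIdx_of_lt hnk
    rw [Set.range_eq_empty, Submodule.span_empty]
    exact bot_le
  · refine Submodule.span_mono ?_
    rintro _ ⟨AB, rfl⟩
    exact ⟨⟨⟨k, Nat.lt_succ_of_le (le_min hnk hk)⟩, AB⟩, rfl⟩

/-- **`∂_{≤d}(permSum) = span of the canonical derivatives of orders `≤ d``** (graded form of the
tree's `partialSpace_permSum_eq_span`): a Hasse derivative of degree `≤ d` of the permutation sum is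
an iterated partial along `≤ d` distinct variables (or `0`), hence a multiple of a canonical
derivative of order `≤ d`; conversely each canonical derivative of order `k` is a Hasse derivative
along `k` distinct variables. Multiplicative coefficients `c` (determinant, permanent).
[cite: AndrewsForbes2022, §5 (p. 29) and Def. 2.19] -/
theorem partialSpaceLE_permSum_eq_span (c : Equiv.Perm (Fin n) → K)
    (hc : ∀ π τ, c (π * τ) = c π * c τ) (d : ℕ) :
    partialSpaceLE d (permSum c) =
      Submodule.span K
        (Set.range (fun p : Σ k : Fin (min n d + 1), PairIdx n k => gen c p.2)) := by
  classical
  refine le_antisymm (Submodule.span_le.2 ?_) (Submodule.span_le.2 ?_)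
  · rintro _ ⟨a, ha, rfl⟩
    change mvHasseDeriv a (permSum c) ∈ _
    by_cases h1 : ∀ v, a v ≤ 1
    · set A := a.support with hA
      have haA : a = sqfree A := eq_sqfree_support_of_forall_le_one h1
      have hl : sqfree (A.toList).toFinset = a := by rw [Finset.toList_toFinset, ← haA]
      have hcard : A.card ≤ d := by
        have h : Finsupp.degree a ≤ d := ha
        rwa [haA, degree_sqfree] at h
      have hmem := iterPDeriv_permSum_mem_span c hc A.toList (Finset.length_toList A)
      rw [← mvHasseDeriv_permSum_of_nodup c _ (Finset.nodup_toList A), hl] at hmem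
      exact span_range_gen_le_span_gradedGen c d hcard hmem
    · push Not at h1
      obtain ⟨v, hv⟩ := h1
      rw [mvHasseDeriv_permSum_eq_zero c hv]
      exact Submodule.zero_mem _
  · rintro _ ⟨⟨k, AB⟩, rfl⟩
    obtain ⟨l, hl, hgen⟩ := gen_mem_derivSet c AB
    dsimp only
    rw [hgen]
    by_cases hnd : l.Nodup
    · rw [← mvHasseDeriv_permSum_of_nodup c l hnd]
      refine Submodule.subset_span ⟨_, ?_, rfl⟩
      change Finsupp.degree (sqfree l.toFinset) ≤ d
      rw [degree_sqfree]
      have h2 := k.2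
      have h3 : l.toFinset.card ≤ l.length := List.toFinset_card_le l
      omega
    · rw [iterPDeriv_permSum_eq_zero_of_not_nodup c hnd]
      exact Submodule.zero_mem _

/-- The canonical derivatives of orders `≤ min(n,d)` are linearly independent (a subfamily of the
tree's `linearIndependent_allGen`). [cite: AndrewsForbes2022, §5 (p. 29)] -/
theorem linearIndependent_gradedGen (c : Equiv.Perm (Fin n) → K) (hc0 : ∀ π, c π ≠ 0) (d : ℕ) :
    LinearIndependent K (fun p : Σ k : Fin (min n d + 1), PairIdx n k => gen c p.2) := by
  have hle : min n d + 1 ≤ n + 1 := Nat.succ_le_succ (min_le_left n d)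
  exact (linearIndependent_allGen c hc0).comp
    (Sigma.map (Fin.castLE hle) fun _ AB => AB)
    ((Fin.castLE_injective hle).sigma_map fun _ => Function.injective_id)

/-- **`dim ∂_{≤d}` of a permutation sum with multiplicative nonvanishing coefficients is
`Σ_{i ≤ d} binom(n,i)²`** (every field): `binom(n,k)²` canonical derivatives of each order `k ≤ d`.
[cite: AndrewsForbes2022, Thm. 5.4 and §5 (p. 29)] -/
theorem finrank_partialSpaceLE_permSum (c : Equiv.Perm (Fin n) → K)
    (hc : ∀ π τ, c (π * τ) = c π * c τ) (hc0 : ∀ π, c π ≠ 0) (d : ℕ) :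
    Module.finrank K (partialSpaceLE d (permSum c)) =
      ∑ i ∈ Finset.range (d + 1), (n.choose i) ^ 2 := by
  rw [partialSpaceLE_permSum_eq_span c hc d,
    finrank_span_eq_card (linearIndependent_gradedGen c hc0 d), Fintype.card_sigma]
  simp_rw [Fintype.card_prod, Fintype.card_finset_len, Fintype.card_fin]
  rw [Fin.sum_univ_eq_sum_range (fun k => n.choose k * n.choose k) (min n d + 1),
    sum_range_choose_sq_eq_min n d]
  exact Finset.sum_congr rfl fun k _ => (sq _).symm

variable (K) in
/-- **`dim ∂_{≤d}(det_n) = Σ_{i ≤ d} binom(n,i)²` over EVERY field** (the Hasse partials of order `k`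
of the determinant span the `(n-k) × (n-k)` minors): the value that Thm. 5.4's second part bounds
from below in characteristic zero is attained by `det_r` in every characteristic.
[cite: AndrewsForbes2022, Thm. 5.4 and §5 (p. 29)] -/
theorem finrank_partialSpaceLE_detPoly (n d : ℕ) :
    Module.finrank K (partialSpaceLE d (detPoly (Fin n) K)) =
      ∑ i ∈ Finset.range (d + 1), (n.choose i) ^ 2 := by
  rw [detPoly_eq_permSum]
  refine finrank_partialSpaceLE_permSum _ (fun π τ => ?_) (fun π => ?_) d
  · rw [Equiv.Perm.sign_mul, Units.val_mul, Int.cast_mul]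
  · rcases Int.units_eq_one_or (Equiv.Perm.sign π) with h | h <;> simp [h]

variable (K) in
/-- The same graded count for the permanent: `dim ∂_{≤d}(perm_n) = Σ_{i ≤ d} binom(n,i)²` over every
field. [cite: AndrewsForbes2022, §5 (p. 29)] -/
theorem finrank_partialSpaceLE_perPoly (n d : ℕ) :
    Module.finrank K (partialSpaceLE d (perPoly (Fin n) K)) =
      ∑ i ∈ Finset.range (d + 1), (n.choose i) ^ 2 := by
  rw [perPoly_eq_permSum]
  exact finrank_partialSpaceLE_permSum _ (fun _ _ => (mul_one _).symm) (fun _ => one_ne_zero) d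

variable {σ τ : Type*}

/-- **`∂_{≤d}(f(φ x)) = (∂_{≤d} f)(φ x)` for an injective renaming `φ`** (graded form of the tree's
`partialSpace_rename`; renaming preserves the degree of a derivative index).
[cite: AndrewsForbes2022, Lemma 2.20 (injective renaming case)] -/
theorem partialSpaceLE_rename {φ : σ → τ} (hφ : Function.Injective φ) (d : ℕ)
    (f : MvPolynomial σ K) :
    partialSpaceLE d (rename φ f) =
      (partialSpaceLE d f).map
        (rename φ : MvPolynomial σ K →ₐ[K] MvPolynomial τ K).toLinearMap := by
  classical
  refine le_antisymm (Submodule.span_le.2 ?_) ?_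
  · rintro _ ⟨a, ha, rfl⟩
    change mvHasseDeriv a (rename φ f) ∈ _
    by_cases has : (↑a.support ⊆ Set.range φ)
    · have hdeg : Finsupp.degree (a.comapDomain φ hφ.injOn) ≤ d := by
        have h := Finsupp.degree_mapDomain φ (a.comapDomain φ hφ.injOn)
        rw [Finsupp.mapDomain_comapDomain φ hφ a has] at h
        rw [← h]
        exact ha
      rw [← Finsupp.mapDomain_comapDomain φ hφ a has, mvHasseDeriv_mapDomain_rename hφ]
      exact Submodule.mem_map_of_mem (Submodule.subset_span ⟨_, hdeg, rfl⟩)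
    · rw [mvHasseDeriv_rename_eq_zero φ has f]
      exact Submodule.zero_mem _
  · rw [partialSpaceLE, Submodule.map_span, Submodule.span_le]
    rintro _ ⟨_, ⟨a, ha, rfl⟩, rfl⟩
    change rename φ (mvHasseDeriv a f) ∈ partialSpaceLE d (rename φ f)
    rw [← mvHasseDeriv_mapDomain_rename hφ]
    refine Submodule.subset_span ⟨_, ?_, rfl⟩
    change Finsupp.degree (Finsupp.mapDomain φ a) ≤ d
    rw [Finsupp.degree_mapDomain]
    exact ha

/-- Injective renaming preserves `dim ∂_{≤d}`. [cite: AndrewsForbes2022, Lemma 2.20 (injective renaming case)] -/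
theorem finrank_partialSpaceLE_rename {φ : σ → τ} (hφ : Function.Injective φ) (d : ℕ)
    (f : MvPolynomial σ K) :
    Module.finrank K (partialSpaceLE d (rename φ f)) = Module.finrank K (partialSpaceLE d f) := by
  rw [partialSpaceLE_rename hφ]
  exact (LinearEquiv.finrank_eq
    (Submodule.equivMapOfInjective _ (fun x y h => rename_injective φ hφ h) _)).symm

/-- **`dim ∂_{≤d}` of every `r × r` minor of the generic `n × m` matrix is `Σ_{i ≤ d} binom(r,i)²`**
(injective row and column selections), every field. [cite: AndrewsForbes2022, Thm. 5.4 and §5 (p. 29)] -/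
theorem finrank_partialSpaceLE_minor {n m r : ℕ} {ρ : Fin r → Fin n} {γ : Fin r → Fin m}
    (hρ : Function.Injective ρ) (hγ : Function.Injective γ) (d : ℕ) :
    Module.finrank K
        (partialSpaceLE d ((Matrix.mvPolynomialX (Fin n) (Fin m) K).submatrix ρ γ).det) =
      ∑ i ∈ Finset.range (d + 1), (r.choose i) ^ 2 := by
  rw [det_submatrix_mvPolynomialX, finrank_partialSpaceLE_rename, finrank_partialSpaceLE_detPoly]
  intro p q h
  rw [Prod.mk.injEq] at h
  exact Prod.ext (hρ h.1) (hγ h.2)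

/-- **Thm. 5.4, second part, is sharp:** in characteristic zero and for `r ≤ min(n, m)`, the least
value of `dim ∂_{≤d}(f)` over the nonzero `f ∈ I^det_{n,m,r}` is `Σ_{i ≤ d} binom(r,i)²`, attained at
an `r × r` minor (`finrank_partialSpaceLE_minor`; lower bound `AndrewsForbes2022_thm_5_4_charZero`).
[cite: AndrewsForbes2022, Thm. 5.4 and §5 (p. 29)] -/
theorem isLeast_finrank_partialSpaceLE_detIdeal (F : Type) [Field F] [CharZero F] {n m r : ℕ}
    (hr : r ≤ min n m) (d : ℕ) :
    IsLeast {k | ∃ f ∈ detIdeal F n m r, f ≠ 0 ∧ Module.finrank F (partialSpaceLE d f) = k}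
      (∑ i ∈ Finset.range (d + 1), (r.choose i) ^ 2) := by
  have hn : r ≤ n := hr.trans (min_le_left n m)
  have hm : r ≤ m := hr.trans (min_le_right n m)
  refine ⟨⟨((Matrix.mvPolynomialX (Fin n) (Fin m) F).submatrix (Fin.castLE hn) (Fin.castLE hm)).det,
    Ideal.subset_span ⟨_, _, rfl⟩,
    rowMinor_ne_zero ⟨r, Fin.castLE hn, Fin.castLE hm⟩ (Fin.castLE_injective hn)
      (Fin.castLE_injective hm),
    finrank_partialSpaceLE_minor (Fin.castLE_injective hn) (Fin.castLE_injective hm) d⟩, ?_⟩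
  rintro k ⟨f, hf, hf0, rfl⟩
  exact sum_choose_sq_le_finrank_partialSpaceLE_of_mem_detIdeal F n m r f hf hf0 d

/-- **Remark 5.5 made quantitative:** in characteristic `p > 0` and for `r ≤ min(n, m)`, the least
value of `dim ∂_{≤1}(f)` over the nonzero `f ∈ I^det_{n,m,r}` is `1` (attained at the `p`-th power of
an `r × r` minor), against `1 + r²` in characteristic zero (`isLeast_finrank_partialSpaceLE_detIdeal`
at `d = 1`). [cite: AndrewsForbes2022, Rem. 5.5] -/
theorem isLeast_finrank_partialSpaceLE_one_detIdeal_charP (p : ℕ) [Fact p.Prime] (F : Type) [Field F]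
    [CharP F p] {n m r : ℕ} (hr : r ≤ min n m) :
    IsLeast {k | ∃ f ∈ detIdeal F n m r, f ≠ 0 ∧ Module.finrank F (partialSpaceLE 1 f) = k} 1 := by
  have hn : r ≤ n := hr.trans (min_le_left n m)
  have hm : r ≤ m := hr.trans (min_le_right n m)
  obtain ⟨h1, h2, h3, -⟩ := AndrewsForbes2022_rem_5_5 p F (r := r)
    ((Matrix.mvPolynomialX (Fin n) (Fin m) F).submatrix (Fin.castLE hn) (Fin.castLE hm)).det
    (Ideal.subset_span ⟨_, _, rfl⟩)
    (rowMinor_ne_zero ⟨r, Fin.castLE hn, Fin.castLE hm⟩ (Fin.castLE_injective hn)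
      (Fin.castLE_injective hm))
  refine ⟨⟨_, h1, h2, h3⟩, ?_⟩
  rintro k ⟨f, -, hf0, rfl⟩
  haveI := finiteDimensional_partialSpaceLE 1 f
  rw [Nat.one_le_iff_ne_zero, Ne, Submodule.finrank_eq_zero]
  intro hbot
  exact hf0 ((Submodule.eq_bot_iff _).1 hbot f (self_mem_partialSpaceLE 1 f))

end GradedDet

end Literature.Computability.AlgebraicComplexity
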